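import Summits.HodgeConjecture.CorCM.GaloisSixteenTableLawsB
import HarnessLib

/-!
# Table models from generators and relations, III: law E on `ZMod 4 × ZMod 2 × ZMod 2`
# (`(i,j,k) ↦ gⁱ cʲ sᵏ`, `c` central, `s g = g^{A₁} c^{B₁} s`, `s² = g^{A₂} c^{B₂}`)

COR-CM (cell `pub-hodgecm2`), binder seat b04 (gen 17), count-neutral claim GALOIS16-COMPLETE.  KERNEL ONLY:
theorems; no definition, no named fact, no `sorry`.  `HC_CM` is neither used nor claimed.  Pure group theory,
continuing `GaloisSixteenTableLawsA/B`.

Law E is the normal form of a group of order `16` WITHOUT elements of order `8` that has an element `g` with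
`g² ∉ {1, c}` (`c` a central involution): `A = ⟨g, c⟩ ≅ C₄ × C₂` has index `2`, any `s ∉ A` conjugates `g` into `A`
and squares into `A` (`GaloisSixteenStructure`).  Coordinates `(i,j,k) ↔ gⁱ cʲ sᵏ`:
`(i,j,k)·(i',j',k') = (i + A₁ᵏ i' + A₂ kk', j + j' + B₁ k i' + B₂ kk', k + k')`.

* `conj_pow_of_rel` — `s gⁿ = (g^{A₁} c^{B₁})ⁿ s` written as `g^{A₁ n} c^{B₁ n} s`;
* **`exists_table_lawE`** — `g` of order `4`, `c` an involution commuting with `g` and `s`, `c ∉ ⟨g⟩`,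
  `gⁱ cʲ s ≠ 1`, the two relations, `|G| = 16` ⟹ a table model `e` for law E with `e g = (1,0,0)`, `e c = (0,1,0)`,
  `e s = (0,0,1)`, `e 1 = (0,0,0)` (consumed with the twelve decided models of `GaloisSixteenDegenerateTablesE30/E11/E31`).

## References

* [Shimura1998] G. Shimura, *Abelian Varieties with Complex Multiplication and Modular Functions*, §8.1.
* [Dodson1984] B. Dodson, *The structure of Galois groups of CM-fields*, Trans. AMS 283 (1984), §5.3.1.
-/

namespace Summit.HodgeConjecture.CorCM.GaloisTableLaws

variable {G : Type*} [Group G]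

/-- `s gⁿ = g^{a n} c^{b n} s` from `s g = gᵃ cᵇ s` when `g` and `c` commute. [folklore] -/
theorem conj_pow_of_rel (g c s : G) (a b : ℕ) (hgc : g * c = c * g) (hsg : s * g = g ^ a * c ^ b * s) (n : ℕ) :
    s * g ^ n = g ^ (a * n) * c ^ (b * n) * s := by
  induction n with
  | zero => simp
  | succ n ih =>
    have hcg : c ^ (b * n) * g ^ a = g ^ a * c ^ (b * n) := (Commute.pow_pow hgc a (b * n)).eq.symm
    calc s * g ^ (n + 1) = s * g ^ n * g := by rw [pow_succ, mul_assoc]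
      _ = g ^ (a * n) * c ^ (b * n) * (s * g) := by rw [ih, mul_assoc]
      _ = g ^ (a * n) * (c ^ (b * n) * g ^ a) * c ^ b * s := by rw [hsg]; simp only [mul_assoc]
      _ = g ^ (a * n) * (g ^ a * c ^ (b * n)) * c ^ b * s := by rw [hcg]
      _ = g ^ (a * (n + 1)) * c ^ (b * (n + 1)) * s := by
        rw [Nat.mul_succ, Nat.mul_succ, pow_add, pow_add]; simp only [mul_assoc]

/-- **Table model for law E.**  `g` of order `4`; `c` an involution commuting with `g` and `s`, `c ∉ ⟨g⟩`;
`gⁱ cʲ s ≠ 1` (`s ∉ ⟨g, c⟩`); `s g = g^{A₁} c^{B₁} s`, `s s = g^{A₂} c^{B₂}` (exponents read in `ZMod 4`, `ZMod 2`);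
`|G| = 16`.  Then the word map `(i,j,k) ↦ gⁱ cʲ sᵏ` inverts to a table model of `G` for law E.  The two table
facts (right quasi-inverses, cancellation) are hypotheses, discharged by `decide` at each of the twelve instances.
[folklore] -/
theorem exists_table_lawE [Finite G] (g c s : G) (A₁ A₂ : ZMod 4) (B₁ B₂ : ZMod 2) (hg : orderOf g = 4)
    (hcg : c ∉ Subgroup.zpowers g) (hs : ∀ i j : ℕ, g ^ i * c ^ j * s ≠ 1) (hcc : c * c = 1)
    (hgc : g * c = c * g) (hsc : s * c = c * s) (hsg : s * g = g ^ A₁.val * c ^ B₁.val * s)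
    (hss : s * s = g ^ A₂.val * c ^ B₂.val) (hcard : Nat.card G = 16)
    (hinv : ∀ q : ZMod 4 × ZMod 2 × ZMod 2, ∃ q',
      (fun p q : ZMod 4 × ZMod 2 × ZMod 2 => (p.1 + (if p.2.2 = 0 then q.1 else A₁ * q.1) +
        (if p.2.2 = 1 ∧ q.2.2 = 1 then A₂ else 0), p.2.1 + q.2.1 + (if p.2.2 = 1 ∧ (q.1 = 1 ∨ q.1 = 3) then B₁ else 0) +
        (if p.2.2 = 1 ∧ q.2.2 = 1 then B₂ else 0), p.2.2 + q.2.2)) q q' = (0, 0, 0))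
    (hcancel : ∀ p q q' : ZMod 4 × ZMod 2 × ZMod 2,
      (fun p q : ZMod 4 × ZMod 2 × ZMod 2 => (p.1 + (if p.2.2 = 0 then q.1 else A₁ * q.1) +
        (if p.2.2 = 1 ∧ q.2.2 = 1 then A₂ else 0), p.2.1 + q.2.1 + (if p.2.2 = 1 ∧ (q.1 = 1 ∨ q.1 = 3) then B₁ else 0) +
        (if p.2.2 = 1 ∧ q.2.2 = 1 then B₂ else 0), p.2.2 + q.2.2)) q q' = (0, 0, 0) →
      (fun p q : ZMod 4 × ZMod 2 × ZMod 2 => (p.1 + (if p.2.2 = 0 then q.1 else A₁ * q.1) +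
        (if p.2.2 = 1 ∧ q.2.2 = 1 then A₂ else 0), p.2.1 + q.2.1 + (if p.2.2 = 1 ∧ (q.1 = 1 ∨ q.1 = 3) then B₁ else 0) +
        (if p.2.2 = 1 ∧ q.2.2 = 1 then B₂ else 0), p.2.2 + q.2.2)) p q' = (0, 0, 0) → p = q) :
    ∃ e : G ≃ ZMod 4 × ZMod 2 × ZMod 2, (∀ u v : G, e (u * v) =
      (fun p q : ZMod 4 × ZMod 2 × ZMod 2 => (p.1 + (if p.2.2 = 0 then q.1 else A₁ * q.1) +
        (if p.2.2 = 1 ∧ q.2.2 = 1 then A₂ else 0), p.2.1 + q.2.1 + (if p.2.2 = 1 ∧ (q.1 = 1 ∨ q.1 = 3) then B₁ else 0) +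
        (if p.2.2 = 1 ∧ q.2.2 = 1 then B₂ else 0), p.2.2 + q.2.2)) (e u) (e v)) ∧
      e g = (1, 0, 0) ∧ e c = (0, 1, 0) ∧ e s = (0, 0, 1) ∧ e 1 = (0, 0, 0) := by
  have hg4 : g ^ 4 = 1 := by rw [← hg]; exact pow_orderOf_eq_one g
  have hc2 : c ^ 2 = 1 := by rw [pow_two, hcc]
  have hv0 : (0 : ZMod 2).val = 0 := rfl
  have hv1 : (1 : ZMod 2).val = 1 := rfl
  set mul : ZMod 4 × ZMod 2 × ZMod 2 → ZMod 4 × ZMod 2 × ZMod 2 → ZMod 4 × ZMod 2 × ZMod 2 :=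
    fun p q => (p.1 + (if p.2.2 = 0 then q.1 else A₁ * q.1) + (if p.2.2 = 1 ∧ q.2.2 = 1 then A₂ else 0),
      p.2.1 + q.2.1 + (if p.2.2 = 1 ∧ (q.1 = 1 ∨ q.1 = 3) then B₁ else 0) + (if p.2.2 = 1 ∧ q.2.2 = 1 then B₂ else 0),
      p.2.2 + q.2.2) with hmul_def
  -- commuting powers
  have hcg' : ∀ m n : ℕ, c ^ m * g ^ n = g ^ n * c ^ m := fun m n => (Commute.pow_pow hgc n m).eq.symm
  have hsc' : ∀ m : ℕ, s * c ^ m = c ^ m * s := fun m => (Commute.pow_right hsc m).eq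
  have hα := conj_pow_of_rel g c s A₁.val B₁.val hgc hsg
  set f : ZMod 4 × ZMod 2 × ZMod 2 → G := fun p => g ^ p.1.val * c ^ p.2.1.val * s ^ p.2.2.val with hf_def
  -- normal forms of products of words (natural exponents)
  have nf0 : ∀ i j i' j' k' : ℕ, (g ^ i * c ^ j * s ^ 0) * (g ^ i' * c ^ j' * s ^ k') =
      g ^ (i + i') * c ^ (j + j') * s ^ k' := by
    intro i j i' j' k'
    calc (g ^ i * c ^ j * s ^ 0) * (g ^ i' * c ^ j' * s ^ k')
        = g ^ i * (c ^ j * g ^ i') * c ^ j' * s ^ k' := by simp only [pow_zero, mul_one, mul_assoc]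
      _ = g ^ i * (g ^ i' * c ^ j) * c ^ j' * s ^ k' := by rw [hcg' j i']
      _ = g ^ (i + i') * c ^ (j + j') * s ^ k' := by simp only [pow_add, mul_assoc]
  have nf1 : ∀ i j i' j' k' : ℕ, (g ^ i * c ^ j * s ^ 1) * (g ^ i' * c ^ j' * s ^ k') =
      g ^ (i + A₁.val * i') * c ^ (j + B₁.val * i' + j') * (s * s ^ k') := by
    intro i j i' j' k'
    calc (g ^ i * c ^ j * s ^ 1) * (g ^ i' * c ^ j' * s ^ k')
        = g ^ i * c ^ j * (s * g ^ i') * c ^ j' * s ^ k' := by simp only [pow_one, mul_assoc]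
      _ = g ^ i * c ^ j * (g ^ (A₁.val * i') * c ^ (B₁.val * i') * s) * c ^ j' * s ^ k' := by rw [hα i']
      _ = g ^ i * (c ^ j * g ^ (A₁.val * i')) * c ^ (B₁.val * i') * (s * c ^ j') * s ^ k' := by
        simp only [mul_assoc]
      _ = g ^ i * (g ^ (A₁.val * i') * c ^ j) * c ^ (B₁.val * i') * (c ^ j' * s) * s ^ k' := by
        rw [hcg' j (A₁.val * i'), hsc' j']
      _ = g ^ (i + A₁.val * i') * c ^ (j + B₁.val * i' + j') * (s * s ^ k') := by
        simp only [pow_add, mul_assoc]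
  have nf11 : ∀ N₁ N₂ : ℕ, g ^ N₁ * c ^ N₂ * (s * s ^ 1) = g ^ (N₁ + A₂.val) * c ^ (N₂ + B₂.val) * s ^ 0 := by
    intro N₁ N₂
    calc g ^ N₁ * c ^ N₂ * (s * s ^ 1) = g ^ N₁ * c ^ N₂ * (g ^ A₂.val * c ^ B₂.val) := by rw [pow_one, hss]
      _ = g ^ N₁ * (c ^ N₂ * g ^ A₂.val) * c ^ B₂.val := by simp only [mul_assoc]
      _ = g ^ N₁ * (g ^ A₂.val * c ^ N₂) * c ^ B₂.val := by rw [hcg' N₂ A₂.val]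
      _ = g ^ (N₁ + A₂.val) * c ^ (N₂ + B₂.val) * s ^ 0 := by simp only [pow_add, pow_zero, mul_one, mul_assoc]
  -- reading a word with congruent exponents
  have hread : ∀ (E₁ : ZMod 4) (E₂ E₃ : ZMod 2) (N₁ N₂ : ℕ), E₁.val % 4 = N₁ % 4 → E₂.val % 2 = N₂ % 2 →
      f (E₁, E₂, E₃) = g ^ N₁ * c ^ N₂ * s ^ E₃.val := by
    intro E₁ E₂ E₃ N₁ N₂ h1 h2
    simp only [hf_def]
    rw [pow_eq_pow_of_mod_eq g hg4 h1, pow_eq_pow_of_mod_eq c hc2 h2]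
  have hvA : ∀ i' : ZMod 4, (A₁ * i').val % 4 = A₁.val * i'.val % 4 := fun i' => by
    rw [ZMod.val_mul]; exact Nat.mod_mod _ _
  have hf : ∀ p q, f (mul p q) = f p * f q := by
    rintro ⟨i, j, k⟩ ⟨i', j', k'⟩
    simp only [hmul_def]
    rcases zmod2_cases k with rfl | rfl
    · -- `k = 0`
      rw [if_pos rfl, if_neg (fun h => absurd h.1 (by decide)), if_neg (fun h => absurd h.1 (by decide)),
        if_neg (fun h => absurd h.1 (by decide)), add_zero, add_zero, add_zero,
        hread (i + i') (j + j') (0 + k') (i.val + i'.val) (j.val + j'.val) (by rw [ZMod.val_add]; omega)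
          (by rw [ZMod.val_add]; omega)]
      simp only [hf_def]
      rw [hv0, nf0, zero_add]
    · -- `k = 1`
      have hB : (j + j' + (if (1 : ZMod 2) = 1 ∧ (i' = 1 ∨ i' = 3) then B₁ else 0)).val % 2 =
          (j.val + B₁.val * i'.val + j'.val) % 2 := by
        rw [ZMod.val_add, ZMod.val_add]
        rcases zmod4_parity i' with ⟨hi', hpar⟩ | ⟨hi', hpar⟩
        · rw [if_pos ⟨rfl, hi'⟩]
          rcases zmod2_cases B₁ with hB1 | hB1
          · rw [hB1, hv0]; omega
          · rw [hB1, hv1]; omega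
        · rw [if_neg (fun h => hi' h.2), ZMod.val_zero]
          rcases zmod2_cases B₁ with hB1 | hB1
          · rw [hB1, hv0]; omega
          · rw [hB1, hv1]; omega
      rw [if_neg (by decide : ¬ (1 : ZMod 2) = 0)]
      have hc10 : ¬ ((1 : ZMod 2) = 1 ∧ (0 : ZMod 2) = 1) := fun h => absurd h.2 (by decide)
      have hc11 : ((1 : ZMod 2) = 1 ∧ (1 : ZMod 2) = 1) := ⟨rfl, rfl⟩
      rcases zmod2_cases k' with rfl | rfl
      · rw [if_neg hc10, if_neg hc10, add_zero, add_zero,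
          hread (i + A₁ * i') _ (1 + 0) (i.val + A₁.val * i'.val) (j.val + B₁.val * i'.val + j'.val) (by
            have := hvA i'; rw [ZMod.val_add]; generalize A₁.val * i'.val = M at this ⊢; omega) hB]
        simp only [hf_def]
        rw [hv0, hv1, nf1, pow_zero, mul_one, show ((1 : ZMod 2) + 0).val = 1 from rfl, pow_one]
      · rw [if_pos hc11, if_pos hc11,
          hread (i + A₁ * i' + A₂) _ (1 + 1) (i.val + A₁.val * i'.val + A₂.val)
            (j.val + B₁.val * i'.val + j'.val + B₂.val) (by
            have := hvA i'; rw [ZMod.val_add, ZMod.val_add]; generalize A₁.val * i'.val = M at this ⊢; omega) (by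
            rw [ZMod.val_add]; generalize B₁.val * i'.val = M at hB ⊢; omega)]
        simp only [hf_def]
        rw [hv1, nf1, nf11, show ((1 : ZMod 2) + 1).val = 0 from rfl]
  have hker : ∀ p, f p = 1 → p = (0, 0, 0) := by
    rintro ⟨i, j, k⟩ h
    simp only [hf_def] at h
    rcases zmod2_cases k with rfl | rfl
    · rw [hv0, pow_zero, mul_one] at h
      rcases zmod2_cases j with rfl | rfl
      · rw [hv0, pow_zero, mul_one] at h
        have hdvd : orderOf g ∣ i.val := orderOf_dvd_of_pow_eq_one h
        rw [hg] at hdvd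
        have hi : i.val = 0 := by have := ZMod.val_lt i; omega
        rw [ZMod.val_eq_zero] at hi
        rw [hi]
      · exfalso
        rw [hv1, pow_one, mul_eq_one_iff_eq_inv] at h
        have h' : c = (g ^ i.val)⁻¹ := by rw [← inv_inj, ← h, inv_inv]
        exact hcg (h' ▸ Subgroup.inv_mem _ (Subgroup.pow_mem _ (Subgroup.mem_zpowers g) _))
    · exact absurd (by rwa [hv1, pow_one] at h) (hs i.val j.val)
  obtain ⟨e, he, hef⟩ := exists_table_equiv_of_words mul (0, 0, 0) f hf hker hinv hcancel
    (by rw [hcard]; simp [ZMod.card])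
  refine ⟨e, he, ?_, ?_, ?_, ?_⟩
  · have h := hef (1, 0, 0)
    simp only [hf_def, hv0, pow_zero, mul_one] at h
    rwa [show (1 : ZMod 4).val = 1 from rfl, pow_one] at h
  · have h := hef (0, 1, 0)
    simp only [hf_def, hv0, hv1, pow_zero, pow_one, mul_one, one_mul, ZMod.val_zero] at h
    exact h
  · have h := hef (0, 0, 1)
    simp only [hf_def, hv0, hv1, pow_zero, pow_one, one_mul, ZMod.val_zero] at h
    exact h
  · have h := hef (0, 0, 0)
    simp only [hf_def, hv0, pow_zero, mul_one, ZMod.val_zero] at h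
    exact h

end Summit.HodgeConjecture.CorCM.GaloisTableLaws
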